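import Mathlib.RingTheory.RootsOfUnity.Basic
import Literature.NumberTheory.Automorphic.RootData
import HarnessLib

/-!
# Reducedness of the root datum of a reductive group: reduction of `isReduced_of_isRootDatumOf`

Trunk T-AUTOMORPHIC (G25 AutomorphicL), companion to `RootData.lean`. The named fact
`Literature.NumberTheory.Automorphic.isReduced_of_isRootDatumOf` (Springer, *Linear Algebraic Groups*, 2nd ed.,
7.4.3–7.4.4: the root system `R(G, T)` of a connected reductive group relative to a maximal
torus is *reduced*) packages a statement about the group `(G, T)` inside Mathlib's
`RootPairing.IsReduced`. This file separates the two layers: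

* `roots_isReduced` (named fact, `def … : Prop`): Springer's Lemma 7.4.4 itself, in the
  vocabulary of `RootData.lean` — if `α, β` are roots of `(G, T)` and `β = c • α` for a rational
  `c = a / b` (i.e. `α ^ a = β ^ b` in the multiplicatively written character group, `a b ≠ 0`),
  then `c = ±1` (i.e. `a = b ∨ a = -b`). This is the whole group-theoretic content; its printed
  proof rests on the structure theory of reductive groups (centralisers `G_α = Z_G((Ker α)°)` of
  singular subtori, 7.1.3, 7.6.4 (i); reductive groups of semisimple rank one, 7.2.4, 7.3.2; roots
  as weights of `T` on the Lie algebra, 8.1.1–8.1.2), none of which exists yet for the concrete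
  `Subgroup (GL n k)` vocabulary of `LinearAlgebraicGroups.lean`. Proved corollaries (granted the
  fact): `roots_isReduced.eq_one_or_eq_neg_one` (`α, α ^ c ∈ R ⇒ c = ±1`) and
  `roots_isReduced.pow_two_notMem` (`α ∈ R ⇒ α ^ 2 ∉ R`).
* `isReduced_of_isRootDatumOf_of_roots_isReduced` (proved): the assembly
  `roots_isReduced → isReduced_of_isRootDatumOf`, i.e. the passage from 7.4.4 to
  `RootPairing.IsReduced` for any `P` that `IsRootDatumOf G T P eX eY`. It uses only that the
  weight lattice `X` of a root pairing over `ℤ` is torsion-free (the pairing is perfect, so `X` is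
  reflexive) and that roots are non-zero.
* `eq_one_of_isZConnected_of_pow_eq_one`, `isMulTorsionFree_characterLattice` (proved): an
  algebraic character of finite order of a Zariski-connected `T ≤ GL n k` is trivial, so the
  character lattice `X*(T)` is torsion-free (Springer 3.2.7 (iii) for tori; the proof is the usual
  one: the kernel is an algebraic subgroup of finite index). This justifies reading
  `α ^ a = β ^ b` as `β = (a / b) • α` in `ℚ ⊗ X*(T)`, i.e. the equivalence of `roots_isReduced`
  with the printed form of 7.4.4.

Remaining DAG for `isReduced_of_isRootDatumOf_holds`: discharge `roots_isReduced`
(Springer 7.4.4 via 7.1.3, 7.2.4, 7.3.2, 7.6.4 (i), 8.1.1–8.1.2; see the literature-prover notes).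

## References

* T. A. Springer, *Linear Algebraic Groups*, 2nd ed., Progress in Mathematics 9, Birkhäuser
  (1998), 3.2.7, 7.4.3, 7.4.4, 8.1.1, 8.1.2.
-/

open scoped IsMulCommutative MatrixGroups

namespace Literature.NumberTheory.Automorphic

variable {k : Type*} [Field k] {n : Type*} [Fintype n] [DecidableEq n]

/-! ### Characters of finite order of a Zariski-connected group -/

section Torsion

variable {T : Subgroup (GL n k)}

/-- The kernel of an algebraic character of an algebraic subgroup `T ≤ GL n k`, viewed as a
subgroup of `GL n k`, is algebraic: it is cut out by the equations of `T` together with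
`p = 1`, where `p` is a polynomial representing the character. [folklore] -/
theorem isAlgebraicSubgroup_map_ker (hT : IsAlgebraicSubgroup T) {χ : ↥T →* kˣ}
    (hχ : IsAlgebraicChar χ) : IsAlgebraicSubgroup (χ.ker.map T.subtype) := by
  obtain ⟨S, hS⟩ := hT
  obtain ⟨p, hp⟩ := hχ
  refine ⟨insert (p - 1) S, Set.ext fun g => ?_⟩
  simp only [SetLike.mem_coe, zeroLocusGL, Set.mem_setOf_eq, Set.forall_mem_insert, map_sub,
    map_one, sub_eq_zero]
  constructor
  · rintro ⟨t, ht, rfl⟩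
    have hmem : (t : GL n k) ∈ zeroLocusGL S := hS ▸ t.2
    refine ⟨?_, hmem⟩
    change MvPolynomial.eval (glCoordFun (t : GL n k)) p = 1
    rw [← hp t, (MonoidHom.mem_ker).mp ht, Units.val_one]
  · rintro ⟨h1, hS'⟩
    have hg : g ∈ T := by
      rw [← SetLike.mem_coe, hS]
      exact hS'
    exact ⟨⟨g, hg⟩, (MonoidHom.mem_ker).mpr (Units.val_eq_one.mp (by rw [hp]; exact h1)), rfl⟩

/-- An algebraic character of finite order of a Zariski-connected subgroup `T ≤ GL n k` is
trivial: its kernel is an algebraic subgroup of finite index (the image lies in the finite group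
of `m`-th roots of unity), hence is all of `T` (Springer 3.2.7 (iii): the character group of a
torus is free). [cite: SpringerLAG1998, 3.2.7 (iii)] -/
theorem eq_one_of_isZConnected_of_pow_eq_one (hT : IsZConnected T) {χ : ↥T →* kˣ}
    (hχ : IsAlgebraicChar χ) {m : ℕ} (hm : m ≠ 0) (h : χ ^ m = 1) : χ = 1 := by
  have hKT : (χ.ker.map T.subtype).subgroupOf T = χ.ker :=
    Subgroup.comap_map_eq_self_of_injective T.subtype_injective _
  have hrange : χ.range ≤ rootsOfUnity m k := by
    rintro _ ⟨t, rfl⟩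
    rw [mem_rootsOfUnity, ← MonoidHom.pow_apply, h, MonoidHom.one_apply]
  have _ : NeZero m := ⟨hm⟩
  have hfin : Finite χ.range :=
    Finite.of_injective _ (Subgroup.inclusion_injective hrange)
  have hidx : ((χ.ker.map T.subtype).subgroupOf T).FiniteIndex := by
    rw [hKT]
    exact ⟨by rw [Subgroup.index_ker]; exact Nat.card_pos.ne'⟩
  have hKeq : χ.ker.map T.subtype = T :=
    hT.2 _ (Subgroup.map_subtype_le _) (isAlgebraicSubgroup_map_ker hT.1 hχ) hidx
  ext1 t
  have ht : (t : GL n k) ∈ χ.ker.map T.subtype := by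
    rw [hKeq]
    exact t.2
  obtain ⟨t', ht', htt'⟩ := ht
  obtain rfl : t' = t := Subtype.ext htt'
  rw [MonoidHom.one_apply, (MonoidHom.mem_ker).mp ht']

/-- The character lattice `X*(T)` of a Zariski-connected subgroup `T ≤ GL n k` is torsion-free
(Springer 3.2.7 (iii): for a torus it is even free of finite rank). In particular, for
`α, β ∈ X*(T)` and integers `a, b ≠ 0`, the relation `α ^ a = β ^ b` says exactly that
`β = (a / b) • α` in `ℚ ⊗ X*(T)`. [cite: SpringerLAG1998, 3.2.7 (iii)] -/
theorem isMulTorsionFree_characterLattice (hT : IsZConnected T) :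
    IsMulTorsionFree ↥(characterLattice T) := by
  refine ⟨fun m hm χ ψ hχψ => ?_⟩
  simp only at hχψ
  rw [← div_eq_one] at hχψ ⊢
  rw [← div_pow] at hχψ
  have h1 : ((χ / ψ : ↥(characterLattice T)) : ↥T →* kˣ) ^ m = 1 := by
    rw [← Subgroup.coe_pow, hχψ, Subgroup.coe_one]
  exact Subtype.ext (eq_one_of_isZConnected_of_pow_eq_one hT (χ / ψ).2 hm h1)

end Torsion

/-! ### Springer 7.4.4 and the reduction of `isReduced_of_isRootDatumOf` -/

section Reduced

variable {G T : Subgroup (GL n k)}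

/-- **The root system of a connected reductive group is reduced** (Springer 7.4.3–7.4.4, for
`G` connected reductive over an algebraically closed field and `T` a maximal torus, where the
roots defined through root homomorphisms, `roots G T`, are the roots `R(G, T)` of 7.4.3 by
8.1.1 (i)–8.1.2). Lemma 7.4.4: *if `α ∈ R`, `c ∈ ℚ` and `c α ∈ R` then `c = ±1`.* In the
multiplicatively written character group `X*(T)` (torsion-free, `isMulTorsionFree_characterLattice`)
the hypothesis "`β = c α` with `c = a / b`" reads `α ^ a = β ^ b` with `a, b ≠ 0`, and the
conclusion `c = ±1` reads `a = b ∨ a = -b`. The printed proof: `G_α = Z_G((Ker α)°) = G_{cα}`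
is connected reductive of semisimple rank one (7.1.3, 7.6.4 (i)), and its roots relative to `T`
are `±α` (7.3.2, 8.1.2). [cite: SpringerLAG1998, 7.4.4 (with 7.4.3, 8.1.1 (i), 8.1.2)] -/
def roots_isReduced : Prop :=
  ∀ [IsAlgClosed k], IsConnectedReductive G → IsMaximalTorusIn T G →
    ∀ {α β : ↥(characterLattice T)}, α ∈ roots G T → β ∈ roots G T →
    ∀ {a b : ℤ}, a ≠ 0 → b ≠ 0 → α ^ a = β ^ b → a = b ∨ a = -b

/-- Integral form of Springer 7.4.4, from `roots_isReduced`: if `α` and `α ^ c` (`c ∈ ℤ`) are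
both roots of `(G, T)` then `c = ±1` (the case `c = 0` is excluded because roots are non-trivial
characters). [cite: SpringerLAG1998, 7.4.4] -/
theorem roots_isReduced.eq_one_or_eq_neg_one (hred : roots_isReduced (G := G) (T := T))
    [IsAlgClosed k] (hG : IsConnectedReductive G) (hT : IsMaximalTorusIn T G)
    {α : ↥(characterLattice T)} (hα : α ∈ roots G T) {c : ℤ} (hc : α ^ c ∈ roots G T) :
    c = 1 ∨ c = -1 := by
  have hc0 : c ≠ 0 := by
    rintro rfl
    rw [zpow_zero] at hc
    exact hc.1 (by simp)
  exact hred hG hT hα hc hc0 one_ne_zero (by rw [zpow_one])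

/-- In particular (Springer 7.4.4 with `c = 2`): if `α` is a root of a connected reductive group
relative to a maximal torus then `α ^ 2` (i.e. `2α`) is not, granted `roots_isReduced`.
[cite: SpringerLAG1998, 7.4.4] -/
theorem roots_isReduced.pow_two_notMem (hred : roots_isReduced (G := G) (T := T))
    [IsAlgClosed k] (hG : IsConnectedReductive G) (hT : IsMaximalTorusIn T G)
    {α : ↥(characterLattice T)} (hα : α ∈ roots G T) : α ^ 2 ∉ roots G T := by
  intro h2
  rcases hred.eq_one_or_eq_neg_one hG hT hα (c := 2) (by rwa [zpow_two, ← pow_two]) with h | h <;>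
    lia

variable {ι X Y : Type*} [AddCommGroup X] [AddCommGroup Y] [IsMulCommutative ↥T]

/-- **Assembly step for `isReduced_of_isRootDatumOf`.** Springer's Lemma 7.4.4
(`roots_isReduced`) implies that every root pairing `P` over `ℤ` which is the root datum of
`(G, T)` (`IsRootDatumOf G T P eX eY`) is reduced in Mathlib's sense (`RootPairing.IsReduced`):
if `s • P.root i + t • P.root j = 0` with `(s, t) ≠ 0`, then `s, t ≠ 0` because roots are
non-zero and the weight lattice of a root pairing over `ℤ` is torsion-free (perfect pairing), the
corresponding roots `α, β` of `(G, T)` satisfy `α ^ s = β ^ (-t)`, so `s = ∓t` by 7.4.4 and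
`P.root i = ± P.root j`. (Springer 7.4.3.) [cite: SpringerLAG1998, 7.4.3–7.4.4] -/
theorem isReduced_of_isRootDatumOf_of_roots_isReduced (hred : roots_isReduced (G := G) (T := T)) :
    isReduced_of_isRootDatumOf (G := G) (T := T) (ι := ι) (X := X) (Y := Y) := by
  intro _ hG hT P eX eY h
  have _iX : Module.IsReflexive ℤ X := .of_isPerfPair P.toLinearMap
  refine ⟨fun i j hij => ?_⟩
  rw [LinearIndependent.pair_iff] at hij
  push Not at hij
  obtain ⟨s, t, hst, hst0⟩ := hij
  have hi : P.root i ∈ Set.range P.root := ⟨i, rfl⟩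
  have hj : P.root j ∈ Set.range P.root := ⟨j, rfl⟩
  rw [h.range_root] at hi hj
  obtain ⟨α, hα, hαi⟩ := hi
  obtain ⟨β, hβ, hβj⟩ := hj
  beta_reduce at hαi hβj
  have hs : s ≠ 0 := by
    rintro rfl
    rw [zero_smul, zero_add, smul_eq_zero_iff_right (hst0 rfl)] at hst
    exact P.ne_zero j hst
  have ht : t ≠ 0 := by
    rintro rfl
    rw [zero_smul, add_zero, smul_eq_zero_iff_right hs] at hst
    exact P.ne_zero i hst
  have key : α ^ s = β ^ (-t) := by
    apply Additive.ofMul.injective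
    apply eX.injective
    rw [ofMul_zpow, ofMul_zpow, map_zsmul, map_zsmul, hαi, hβj, neg_smul,
      eq_neg_iff_add_eq_zero, hst]
  rcases hred hG hT hα hβ hs (neg_ne_zero.mpr ht) key with rfl | rfl
  · -- `s = -t`: `s • (P.root i - P.root j) = 0`
    left
    have h0 : -t • (P.root i - P.root j) = 0 := by
      rw [smul_sub, sub_eq_add_neg, ← neg_smul, neg_neg, hst]
    rwa [smul_eq_zero_iff_right hs, sub_eq_zero] at h0
  · -- `s = t`: `t • (P.root i + P.root j) = 0`
    right
    rw [neg_neg] at hst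
    have h0 : t • (P.root i + P.root j) = 0 := by rw [smul_add, hst]
    rwa [smul_eq_zero_iff_right ht, add_eq_zero_iff_eq_neg] at h0

end Reduced

end Literature.NumberTheory.Automorphic
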